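import Summits.QuantumFields.YangMills.Theses.XiPowWidening
import Literature.MathematicalPhysics.QuantumLattice.LatticeGaugeDLRGibbsProofs
import Literature.MathematicalPhysics.QuantumFieldTheory.Balaban1983to89.InfiniteVolumeSufficientIV

/-!
# Route `XiPowWidening` (QuantumFields / YangMills; rung-R2ξ leaf `WeakCouplingRates.XiPow`, all compact simple `G`) —
# support item `XiPowOfLimitPointFloorG` (stmt-QuantumFields-22470), PROVED

The kernel transfer in WCR currency, per `(G, r)`: a floor `κ β^(−2) n^(−p)` on the connected (1,2)-plaquette-cost time
correlator `rpCorr μ (plaqCost0 r.ρ 1 2) n` at all `1 ≤ n ≤ 2β^A`, for every infinite-volume torus limit point `μ` and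
every `β ≥ β₀`, gives `∃ ε > 0, MassGapPowerDecayOf 4 r.ρ ε` with `ε = A/2`.

THE ARGUMENT.  Step 1: with `F = plaqCost0 r.ρ 1 2` (a positive-time observable by `plaqCost0_support`, continuous and
bounded by `C` by `continuous_bounded_plaqCost0 r.continuous`, time-reflection invariant by `comp_timeReflectLG_eq`), the
spectral lemma `HasRPTimeGap.le_log_div` at `t = ⌈β^A⌉₊`, `δ = κ β^(−2) t^(−p)`, `V = C² + 1 ≥ rpCorr μ F 0` yields the
explicit rate `MassGapUpperRateOf 4 r.ρ (β ↦ (log (C²+1) − log κ + 2 log β + p log ⌈β^A⌉₊) / ⌈β^A⌉₊)`.  Step 2: since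
`log β = o(β^{A/2})`, that rate is eventually `≤ β^(−A/2)`, and `massGapUpperRateOf_mono` concludes.

Provenance: the proof is the planner's birth-certificate artefact (ym-idea-1 g0, `bc/XiPowWidening_supports.lean`,
attached as evidence on the item 2026-08-27), landed verbatim up to the tree's naming conventions.

WHAT THIS IS NOT: not a proof of the route's cruxes `CorrelatorRigidityG` (r2) / `WitnessStateFloorG` (r3), not a mass
gap, not Clay — the route bears on the RECORD rung R2ξ (an UPPER bound on the gap) and no summit is proved by it.
-/

namespace Summit.QuantumFields.YangMills.Theorems

open MeasureTheory Filter Topology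
open Literature.MathematicalPhysics.QuantumFieldTheory
open Literature.MathematicalPhysics.QuantumLattice
open Summit.QuantumFields.YangMills.Theorems.WeakCouplingRates

/-- **Support item `XiPowOfLimitPointFloorG` of route `XiPowWidening` (stmt-QuantumFields-22470), PROVED**: for a compact
simple `G` and a faithful unitary lattice representation `r`, a floor `κ β^(−2) n^(−p)` at all `1 ≤ n ≤ 2β^A` on the
connected (1,2)-plaquette-cost time correlator of every infinite-volume torus limit point (`β ≥ β₀`) gives XI-POW(A/2):
`∃ ε > 0, MassGapPowerDecayOf 4 r.ρ ε`. -/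
theorem xiPowWidening_xiPowOfLimitPointFloorG_proof :
    Summit.QuantumFields.YangMills.Theses.XiPowWidening.XiPowOfLimitPointFloorG := by
  intro G _ _ _ _ _hG
  letI : MeasurableSpace G := borel G
  haveI : BorelSpace G := ⟨rfl⟩
  intro r h
  obtain ⟨A, κ, β₀, p, hA, hκ, H⟩ := h
  obtain ⟨hcont, C, hC⟩ := continuous_bounded_plaqCost0 (d := 4) r.ρ r.continuous (1 : Fin 4) 2
  obtain ⟨hcyl, hS⟩ := plaqCost0_support (G := G) (d := 4) r.ρ (i := (1 : Fin 4)) (j := 2) (by decide) (by decide)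
  refine ⟨A / 2, by linarith, ?_⟩
  set F : LGConfig 4 G → ℝ := plaqCost0 (d := 4) r.ρ (1 : Fin 4) 2 with hFdef
  have hposF : IsPosTimeObs F := ⟨⟨_, hcyl, fun e he => (hS e he).1.ge⟩, hcont, C, hC⟩
  have hrefl : ∀ U : LGConfig 4 G, F (timeReflectLG U) = F U := comp_timeReflectLG_eq hcyl hS
  -- Step 1: the explicit rate `log(V/δ)/t` at `t = ⌈β^A⌉₊`, `δ = κ β^(−2)/t^p`, `V = C² + 1`.
  have hrate : MassGapUpperRateOf 4 r.ρ (fun β =>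
      (Real.log (C ^ 2 + 1) - Real.log κ + 2 * Real.log β + p * Real.log (⌈β ^ A⌉₊ : ℝ)) / (⌈β ^ A⌉₊ : ℝ)) := by
    refine ⟨max β₀ 1, fun β hβ μ hμ m hm => ?_⟩
    have hβ0 : β₀ ≤ β := (le_max_left _ _).trans hβ
    have hβ1 : (1 : ℝ) ≤ β := (le_max_right _ _).trans hβ
    have hβpos : 0 < β := by linarith
    have hβA : 1 ≤ β ^ A := Real.one_le_rpow hβ1 hA.le
    have htge : β ^ A ≤ (⌈β ^ A⌉₊ : ℝ) := Nat.le_ceil _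
    have htpos : (0 : ℝ) < (⌈β ^ A⌉₊ : ℝ) := by linarith
    have ht1 : 1 ≤ ⌈β ^ A⌉₊ := by exact_mod_cast (show (1 : ℝ) ≤ (⌈β ^ A⌉₊ : ℝ) by linarith)
    have htle : ((⌈β ^ A⌉₊ : ℕ) : ℝ) ≤ 2 * β ^ A := by
      have := Nat.ceil_lt_add_one (by positivity : (0 : ℝ) ≤ β ^ A); linarith
    have hfloor := H β hβ0 μ hμ (⌈β ^ A⌉₊) ht1 htle
    have hδ : 0 < κ * β ^ (-(2 : ℝ)) / ((⌈β ^ A⌉₊ : ℕ) : ℝ) ^ p := by positivity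
    -- `μ` is a probability measure (limit point), so `rpCorr μ F 0 ≤ C² + 1`
    obtain ⟨Lk, hmono, hprob, hlim⟩ := hμ
    haveI := hprob
    have hcorr_0 : rpCorr μ F 0 ≤ C ^ 2 + 1 := by
      simp only [rpCorr, hrefl, timeShiftLG_zero]
      have h1 : (∫ U, F U * F U ∂μ) ≤ C ^ 2 := by
        have hb : ∀ᵐ U ∂μ, ‖F U * F U‖ ≤ C ^ 2 := ae_of_all _ fun U => by
          rw [Real.norm_eq_abs, abs_mul, sq]
          exact mul_le_mul (hC _) (hC _) (abs_nonneg _) ((abs_nonneg _).trans (hC U))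
        have := norm_integral_le_of_norm_le_const hb
        rw [probReal_univ, mul_one, Real.norm_eq_abs] at this
        exact (le_abs_self _).trans this
      nlinarith [mul_self_nonneg (∫ U, F U ∂μ)]
    have hm_le := hm.le_log_div hposF ht1 hδ hfloor hcorr_0
    -- compute the logarithm
    have hV : (0 : ℝ) < C ^ 2 + 1 := by positivity
    have htp : (0 : ℝ) < ((⌈β ^ A⌉₊ : ℕ) : ℝ) ^ p := by positivity
    have hb2 : (0 : ℝ) < β ^ (-(2 : ℝ)) := Real.rpow_pos_of_pos hβpos _
    have hlog : Real.log ((C ^ 2 + 1) / (κ * β ^ (-(2 : ℝ)) / ((⌈β ^ A⌉₊ : ℕ) : ℝ) ^ p)) =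
        Real.log (C ^ 2 + 1) - Real.log κ + 2 * Real.log β + p * Real.log (⌈β ^ A⌉₊ : ℝ) := by
      rw [Real.log_div hV.ne' hδ.ne', Real.log_div (mul_pos hκ hb2).ne' htp.ne', Real.log_mul hκ.ne' hb2.ne',
        Real.log_rpow hβpos, Real.log_pow]
      ring
    rw [hlog] at hm_le
    exact hm_le
  -- Step 2: the explicit rate is eventually `≤ β^(−A/2)`.
  show MassGapUpperRateOf 4 r.ρ (fun β => β ^ (-(A / 2)))
  refine massGapUpperRateOf_mono r.ρ ?_ hrate
  have hA2 : 0 < A / 2 := by linarith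
  have hnum : Tendsto (fun β : ℝ =>
      ((Real.log (C ^ 2 + 1) - Real.log κ + p * Real.log 2) + (2 + p * A) * Real.log β) / β ^ (A / 2))
      atTop (𝓝 0) := by
    have h1 : Tendsto (fun β : ℝ => (Real.log (C ^ 2 + 1) - Real.log κ + p * Real.log 2) / β ^ (A / 2))
        atTop (𝓝 0) :=
      tendsto_const_nhds.div_atTop (tendsto_rpow_atTop hA2)
    have h2 : Tendsto (fun β : ℝ => (2 + p * A) * (Real.log β / β ^ (A / 2))) atTop (𝓝 ((2 + p * A) * 0)) :=
      ((isLittleO_log_rpow_atTop hA2).tendsto_div_nhds_zero).const_mul _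
    rw [mul_zero] at h2
    have h3 := h1.add h2
    rw [add_zero] at h3
    refine h3.congr (fun β => ?_)
    ring
  have hev : ∀ᶠ β : ℝ in atTop,
      ((Real.log (C ^ 2 + 1) - Real.log κ + p * Real.log 2) + (2 + p * A) * Real.log β) / β ^ (A / 2) ≤ 1 :=
    (hnum.eventually (eventually_le_nhds zero_lt_one)).mono fun β h => h
  filter_upwards [hev, eventually_ge_atTop 1] with β hβ1 hβ
  have hβpos : 0 < β := by linarith
  have hβA : 1 ≤ β ^ A := Real.one_le_rpow hβ hA.le
  have hβA0 : 0 < β ^ A := by linarith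
  have htge : β ^ A ≤ (⌈β ^ A⌉₊ : ℝ) := Nat.le_ceil _
  have htpos : (0 : ℝ) < (⌈β ^ A⌉₊ : ℝ) := by linarith
  have htle : ((⌈β ^ A⌉₊ : ℕ) : ℝ) ≤ 2 * β ^ A := by
    have := Nat.ceil_lt_add_one (by positivity : (0 : ℝ) ≤ β ^ A); linarith
  have hlogt : Real.log (⌈β ^ A⌉₊ : ℝ) ≤ Real.log 2 + A * Real.log β := by
    have := Real.log_le_log htpos htle
    rwa [Real.log_mul two_ne_zero hβA0.ne', Real.log_rpow hβpos] at this
  have hp0 : (0 : ℝ) ≤ p := Nat.cast_nonneg p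
  have hnumle : Real.log (C ^ 2 + 1) - Real.log κ + 2 * Real.log β + p * Real.log (⌈β ^ A⌉₊ : ℝ) ≤
      (Real.log (C ^ 2 + 1) - Real.log κ + p * Real.log 2) + (2 + p * A) * Real.log β := by
    nlinarith [mul_le_mul_of_nonneg_left hlogt hp0]
  have hK : (Real.log (C ^ 2 + 1) - Real.log κ + p * Real.log 2) + (2 + p * A) * Real.log β ≤ β ^ (A / 2) :=
    (div_le_one (Real.rpow_pos_of_pos hβpos _)).1 hβ1
  have htarget : β ^ (A / 2) / β ^ A = β ^ (-(A / 2)) := by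
    rw [← Real.rpow_sub hβpos]
    congr 1
    ring
  rcases le_or_gt 0 ((Real.log (C ^ 2 + 1) - Real.log κ + p * Real.log 2) + (2 + p * A) * Real.log β) with hpos | hneg
  · calc (Real.log (C ^ 2 + 1) - Real.log κ + 2 * Real.log β + p * Real.log (⌈β ^ A⌉₊ : ℝ)) / (⌈β ^ A⌉₊ : ℝ)
        ≤ ((Real.log (C ^ 2 + 1) - Real.log κ + p * Real.log 2) + (2 + p * A) * Real.log β) / (⌈β ^ A⌉₊ : ℝ) :=
          div_le_div_of_nonneg_right hnumle htpos.le
      _ ≤ ((Real.log (C ^ 2 + 1) - Real.log κ + p * Real.log 2) + (2 + p * A) * Real.log β) / β ^ A :=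
          div_le_div_of_nonneg_left hpos hβA0 htge
      _ ≤ β ^ (A / 2) / β ^ A := div_le_div_of_nonneg_right hK hβA0.le
      _ = β ^ (-(A / 2)) := htarget
  · calc (Real.log (C ^ 2 + 1) - Real.log κ + 2 * Real.log β + p * Real.log (⌈β ^ A⌉₊ : ℝ)) / (⌈β ^ A⌉₊ : ℝ)
        ≤ ((Real.log (C ^ 2 + 1) - Real.log κ + p * Real.log 2) + (2 + p * A) * Real.log β) / (⌈β ^ A⌉₊ : ℝ) :=
          div_le_div_of_nonneg_right hnumle htpos.le
      _ ≤ 0 := (div_neg_of_neg_of_pos hneg htpos).le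
      _ ≤ β ^ (-(A / 2)) := (Real.rpow_pos_of_pos hβpos _).le

end Summit.QuantumFields.YangMills.Theorems
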